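import Mathlib.Analysis.SpecialFunctions.Pow.Asymptotics
import Mathlib.Analysis.SpecialFunctions.Log.Basic
import Mathlib.Analysis.Asymptotics.SpecificAsymptotics

/-!
# Stub `stub_rateDiverges` of line `determinant-tilt`
(crux `Summit.QuantumFields.QCD.Theses.SpectralDefectExtinction.ExtinctionBuildsQCD`, item stmt-QuantumFields-18064)

RARITY BEATS REACH, abstract form: elementary real analysis.  Let `x_k → ∞` (read `x_k = log a_k⁻¹`),
`0 < Z_k ≤ C x_k^γ` eventually with `γ < 1` (read `HasMassScaling`, `γ = γ₀/2β₀ ∈ {12/29, 4/9}`), and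
`q x_k ≤ ℓog_k` eventually (read POLYGROWTH, `ℓog_k = log(κ c m · a_k L_k)`).  Then for every `m > 0` and every
constant `K` the physical sign-sector rate `(m/Z_k)(ℓog_k − log Z_k − K)` tends to `+∞`.

Proof: `log = o(id)` at `+∞` (`Real.isLittleO_log_id_atTop`) composed with `x → ∞` gives eventually
`|γ| log x_k + (log C + K) ≤ (q/2) x_k`, whence `log Z_k ≤ log C + γ log x_k` yields the bracket bound
`(q/2) x_k ≤ ℓog_k − log Z_k − K`; with `1/Z_k ≥ 1/(C x_k^γ)` the rate is minorised by
`(m q/(2C)) x_k^{1−γ} → ∞` (`tendsto_rpow_atTop`, `1 − γ > 0`).  The helper `rate_diverges` (implicit binders) is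
copied from the planner's sketch `Cruxes/ExtinctionBuildsQCD/Sketch_determinant_tilt.lean`; the registered stub
`stub_rateDiverges` is its fully explicit `∀`-form.

Mathlib only; no named facts are used.
-/

noncomputable section

namespace Summit.QuantumFields.QCD.Cruxes.ExtinctionBuildsQCD.DeterminantTilt

open Filter

-- adapted from Cruxes/ExtinctionBuildsQCD/Sketch_determinant_tilt.lean (`rate_diverges`, §4)
/-- **Rarity beats reach (abstract form, implicit binders).** Let `x_k → ∞` (read `x_k = log a_k⁻¹`),
`0 < Z_k ≤ C x_k^γ` eventually with `γ < 1` (read `HasMassScaling`, `γ = γ₀/2β₀ = 12/29, 4/9`), and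
`q x_k ≤ ℓog_k` eventually (read POLYGROWTH: `ℓog_k = log(κ₁θ c m · a_k L_k)`, any fixed shift absorbed).  Then
for every `m > 0` and every constant `K` the physical sign-sector rate `(m / Z_k) · (ℓog_k − log Z_k − K)` —
kinematic rate `∝ m/Z_k` times `log(1/(ρ_k R_k⁴))/4 ≥ log(a_kL_k/Z_k) − K` — tends to `+∞`. [folklore] -/
theorem rate_diverges {x Z ℓog : ℕ → ℝ} {q γ C : ℝ} (hq : 0 < q) (hγ : γ < 1) (hC : 0 < C)
    (hx : Tendsto x atTop atTop) (hZpos : ∀ k, 0 < Z k)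
    (hZ : ∀ᶠ k in atTop, Z k ≤ C * (x k) ^ γ) (hℓ : ∀ᶠ k in atTop, q * x k ≤ ℓog k)
    {m : ℝ} (hm : 0 < m) (K : ℝ) :
    Tendsto (fun k => m / Z k * (ℓog k - Real.log (Z k) - K)) atTop atTop := by
  -- Step 1: `log` is little-o of the identity, composed with `x → ∞`
  have hlog : ∀ᶠ k in atTop, |γ| * Real.log (x k) + (Real.log C + K) ≤ q / 2 * x k := by
    have h1 : ∀ᶠ y : ℝ in atTop, ‖Real.log y‖ ≤ (q / (4 * (|γ| + 1))) * ‖y‖ :=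
      (Asymptotics.isLittleO_iff.1 Real.isLittleO_log_id_atTop) (by positivity)
    have h2 : ∀ᶠ k in atTop, ‖Real.log (x k)‖ ≤ (q / (4 * (|γ| + 1))) * ‖x k‖ := hx.eventually h1
    have h3 : ∀ᶠ k in atTop, (4 / q) * (Real.log C + K) ≤ x k := hx.eventually_ge_atTop _
    have h4 : ∀ᶠ k in atTop, (1 : ℝ) ≤ x k := hx.eventually_ge_atTop _
    filter_upwards [h2, h3, h4] with k hk2 hk3 hk4
    have hxpos : 0 < x k := by linarith
    rw [Real.norm_eq_abs, Real.norm_eq_abs, abs_of_pos hxpos] at hk2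
    have hγ1 : 0 < |γ| + 1 := by positivity
    have e1 : |γ| * Real.log (x k) ≤ |γ| * (q / (4 * (|γ| + 1)) * x k) :=
      mul_le_mul_of_nonneg_left (le_trans (le_abs_self _) hk2) (abs_nonneg γ)
    have e2 : |γ| * (q / (4 * (|γ| + 1)) * x k) ≤ q / 4 * x k := by
      rw [← mul_assoc]
      apply mul_le_mul_of_nonneg_right _ hxpos.le
      have hfrac : |γ| / (|γ| + 1) ≤ 1 := (div_le_one hγ1).2 (by linarith)
      calc |γ| * (q / (4 * (|γ| + 1))) = q / 4 * (|γ| / (|γ| + 1)) := by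
            field_simp
        _ ≤ q / 4 * 1 := by gcongr
        _ = q / 4 := mul_one _
    have e3 : Real.log C + K ≤ q / 4 * x k := by
      have := mul_le_mul_of_nonneg_left hk3 (by positivity : (0 : ℝ) ≤ q / 4)
      rw [← mul_assoc] at this
      have hq4 : q / 4 * (4 / q) = 1 := by field_simp
      rw [hq4, one_mul] at this
      exact this
    linarith
  -- Step 2: the eventual lower bound `m q /(2C) · x^{1-γ} ≤ rate`
  have hbound : ∀ᶠ k in atTop,
      m * q / (2 * C) * (x k) ^ (1 - γ) ≤ m / Z k * (ℓog k - Real.log (Z k) - K) := by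
    have h4 : ∀ᶠ k in atTop, (1 : ℝ) ≤ x k := hx.eventually_ge_atTop _
    filter_upwards [hZ, hℓ, hlog, h4] with k hkZ hkℓ hkl hk1
    have hxpos : 0 < x k := by linarith
    have hxγ : 0 < (x k) ^ γ := Real.rpow_pos_of_pos hxpos γ
    -- log Z ≤ log C + γ log x ≤ log C + |γ| |log x| ; here log x ≥ 0
    have hlx : 0 ≤ Real.log (x k) := Real.log_nonneg hk1
    have hlogZ : Real.log (Z k) ≤ Real.log C + |γ| * Real.log (x k) := by
      have := Real.log_le_log (hZpos k) hkZ
      rw [Real.log_mul hC.ne' hxγ.ne', Real.log_rpow hxpos] at this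
      have hγl : γ * Real.log (x k) ≤ |γ| * Real.log (x k) :=
        mul_le_mul_of_nonneg_right (le_abs_self γ) hlx
      linarith
    have hbr : q / 2 * x k ≤ ℓog k - Real.log (Z k) - K := by linarith
    have hbr0 : 0 ≤ ℓog k - Real.log (Z k) - K := le_trans (by positivity) hbr
    -- 1/Z ≥ 1/(C x^γ)
    have hinv : 1 / (C * (x k) ^ γ) ≤ 1 / Z k := one_div_le_one_div_of_le (hZpos k) hkZ
    have hsplit : (x k) ^ (1 - γ) = x k / (x k) ^ γ := by
      rw [Real.rpow_sub hxpos, Real.rpow_one]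
    calc m * q / (2 * C) * (x k) ^ (1 - γ)
        = (m * (1 / (C * (x k) ^ γ))) * (q / 2 * x k) := by rw [hsplit]; field_simp
      _ ≤ (m * (1 / Z k)) * (ℓog k - Real.log (Z k) - K) := by
          apply mul_le_mul (mul_le_mul_of_nonneg_left hinv hm.le) hbr (by positivity)
          exact mul_nonneg hm.le (by rw [one_div]; exact inv_nonneg.2 (hZpos k).le)
      _ = m / Z k * (ℓog k - Real.log (Z k) - K) := by rw [mul_one_div]
  -- Step 3: the minorant tends to `+∞`
  have hmin : Tendsto (fun k => m * q / (2 * C) * (x k) ^ (1 - γ)) atTop atTop := by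
    have hpow : Tendsto (fun k => (x k) ^ (1 - γ)) atTop atTop :=
      (tendsto_rpow_atTop (by linarith : (0 : ℝ) < 1 - γ)).comp hx
    exact hpow.const_mul_atTop (by positivity)
  exact tendsto_atTop_mono' atTop hbound hmin

/-- **Stub R (`stub_rateDiverges`) — RARITY BEATS REACH, abstract form (explicit `∀`-form of `rate_diverges`).** Let
`x_k → ∞` (read `log a_k⁻¹`), `0 < Z_k ≤ C x_k^γ` eventually with `γ < 1` (read `HasMassScaling`, `γ = γ₀/2β₀ ∈ {12/29, 4/9}`), and
`q x_k ≤ ℓog_k` eventually (read POLYGROWTH, `ℓog_k = log(κ c m · a_k L_k)`). Then for every `m > 0` and constant `K` the physical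
sign-sector rate `(m/Z_k)(ℓog_k − log Z_k − K)` — kinematic rate `∝ m/Z_k` per lattice unit times the Kotecký–Preiss gain
`log(1/(ρ_k R_k⁴))/4 ≥ log(a_kL_k/Z_k) − K` — tends to `+∞`. [folklore] -/
theorem stub_rateDiverges :
    (∀ (x Z ℓog : ℕ → ℝ) (q γ C : ℝ), 0 < q → γ < 1 → 0 < C → Tendsto x atTop atTop → (∀ k, 0 < Z k) →
      (∀ᶠ k in atTop, Z k ≤ C * (x k) ^ γ) → (∀ᶠ k in atTop, q * x k ≤ ℓog k) →
      ∀ (m : ℝ), 0 < m → ∀ K : ℝ, Tendsto (fun k => m / Z k * (ℓog k - Real.log (Z k) - K)) atTop atTop) :=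
  fun _x _Z _ℓog _q _γ _C hq hγ hC hx hZpos hZ hℓ _m hm K => rate_diverges hq hγ hC hx hZpos hZ hℓ hm K

end Summit.QuantumFields.QCD.Cruxes.ExtinctionBuildsQCD.DeterminantTilt
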